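import Summits.HubbardSuperconductivity.HubbardLadder.Bounds.TwistInsensitivityCluster
import Summits.HubbardSuperconductivity.HubbardLadder.Bounds.TwistedCouplingDegree
import Literature.Probability.LatticeModels.WeightedSmallActivity
import Mathlib.Analysis.Complex.ExponentialBounds
import HarnessLib

/-!
# Twist insensitivity of the grand-canonical `t–t'` Hubbard torus for `T ≥ 400(|t|+|t'|)`:
# bounds.tex Theorem 12 (i)–(ii) with the Catalan entropy bound AND the optimal anchored weight

HONEST FRAMING (cell pub-hubbard): ladder R1–R4 with certified numbers; no claim on H/H₀. This file
is a BOUND FOR A MODEL CLASS (the seam-twisted `t–t'` Hubbard torus at high temperature, any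
filling, both signs of `U`); it makes no materials claim. LEAN FILING REQUEST #196 (bounds g25, one
cell file); imports #181.6 (`TwistInsensitivityCluster`), #195.4 (`TwistedCouplingDegree`, hence the
generic parts #195.1–#195.3) and the tree's `Literature.Probability.LatticeModels.WeightedSmallActivity`
(Kotecký–Preiss smallness with anchored weight `a|·|`, `IsSmallActivityA`).

## What is proved (0 sorry)

Write `Z_L(θ) = Tr e^{-β(H^{tt'}_L(t',U;θ) - μN)}` (`hubbardTorusTT'FluxMu`, #181.1; `L ≥ 3`, hopping `t = 1`,
`t'` arbitrary, ONE seam column twisted by `e^{±iθ}`) and `s = |β|(1+|t'|) = (|t|+|t'|)/T`.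

THEOREM (`abs_log_partitionFn_twist_sub_le_weight`). If `a > 0`, `δ > 0` and

  `16 s · e^{1+2s} · (e^{a+δ} + a)² ≤ a`                                                  (KP-W)

then for every twist `θ`, every `U : ℝ` and every `μ : ℝ`: `|log Z_L(0) - log Z_L(θ)| ≤ 2a L² e^{-δL}`.

INSTANCE (`abs_log_partitionFn_twist_sub_le_of_le_inv_400`): (KP-W) holds with `a = 3/8`, `δ = 10⁻³`
as soon as `s ≤ 1/400`, i.e. for all temperatures `T ≥ 400 (|t|+|t'|)`; then
`|log Z_L(0) - log Z_L(θ)| ≤ (3/4) L² e^{-L/1000}`. (#195.5 is the case `a = 1` of (KP-W), window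
`T ≥ 610(|t|+|t'|)`; the scheme-exact threshold of (KP-W) at `δ = 10⁻³` is `s* = 1/391.0` at `a ≈ 0.37`,
essentially attained by `a = 3/8`. The paper's Theorem 12 has `T ≥ 160(|t|+|t'|)` with the Hölder weights
`e^{|c_b|}-1` in place of the Cauchy weights `|c_b| e^{1+|c_b|}` used here and in #195.)

NODES (all PROVED here): `HighTemperatureTwistInsensitivityTT'Weighted` / `HighTemperatureNoThermalStiffnessTT'Weighted`
(general `a, δ` form) and `HighTemperatureTwistInsensitivityTT'At400` / `HighTemperatureNoThermalStiffnessTT'At400`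
(the reading `β > 0`, `β(1+|t'|) ≤ 1/400`: twist insensitivity `(3/4)L² e^{-L/1000}` and no thermal flux
stiffness, uniformly in `U` and `μ`).

## Proof

Identical to #195.5 with the anchored Kotecký–Preiss weight `a(A) = a|A|` instead of `|A|`: the Catalan
smallness theorem of #195.3 (`sum_norm_couplingActivity_mul_exp_le_catalan`, any rate and any `F` with
`e^{rate} + W F² ≤ F`) is applied with rate `a+δ` and `F = e^{a+δ} + a`, so that (KP-W) is exactly
`e^{a+δ} + W F² ≤ F` with `W = 16 s e^{1+2s} ≥ Σ_{b ∋ v} |c_b| e^{1+|c_b|}` (#195.4) and the one-site sum is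
`≤ F - e^{a+δ} = a`; the tree's `IsSmallActivityA` theory then gives zero-freeness, the logarithm and the
two-gas tail `2a|Λ| e^{-δR}` with `R = L` (the activities of `θ` and `0` agree on polymers with `< L`
sites, #181.6 `ttActivity_eq_of_card_lt`), and `Re (log Ξ_θ - log Ξ_0) = log Z_L(θ) - log Z_L(0)` as in
#181.6. The instance: `e ≤ 2.7182818286`, `e^{2s} ≤ 1/(1-2s) ≤ 400/398`, `e^{0.376} ≤ 1.4566` (Taylor with
remainder, `Real.exp_bound'`), and `16·(1/400)·2.7182818286·(400/398)·(1.4566+0.375)² = 0.36660 ≤ 3/8`.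

References: Kotecký–Preiss, Comm. Math. Phys. 103 (1986) 491, Theorem p. 492; D. Ueltschi,
arXiv:cond-mat/9810320 §3; bounds.tex §12 (Theorem 12, Lemmas 12.3–12.5, Remark 12 (d)).
-/

namespace Summit.HubbardSuperconductivity.HubbardLadder.Bounds

open Matrix Finset Literature.MathematicalPhysics.QuantumLattice
  Literature.MathematicalPhysics.QuantumFieldTheory Literature.Probability.LatticeModels
open scoped ComplexConjugate ComplexOrder

/-! ### The twisted `t–t'` torus: weighted Catalan smallness and the twist-insensitivity tail -/

section Torus

variable {L : ℕ} [NeZero L]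

/-- **One-site Kotecký–Preiss smallness of the twisted activities, weighted Catalan form**: with
`s = |β|(1+|t'|)`, if `a, δ ≥ 0` and `16 s e^{1+2s} (e^{a+δ}+a)² ≤ a` then
`Σ_{A ∋ x} |ρ_θ(A)| e^{(a+δ)|A|} ≤ a` for every site `x` and every `θ, U, μ`. [this file] -/
theorem sum_norm_ttActivity_mul_exp_le_weight (hL : 3 ≤ L) (β t' U μ θ : ℝ) {a δ : ℝ} (ha : 0 ≤ a)
    (hδ : 0 ≤ δ)
    (hsmall : 16 * (|β| * (1 + |t'|)) * Real.exp (1 + 2 * (|β| * (1 + |t'|))) *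
      (Real.exp (a + δ) + a) ^ 2 ≤ a)
    (x : FermionTorus 2 L) (𝒜 : Finset (Finset (FermionTorus 2 L))) (h𝒜 : ∀ A ∈ 𝒜, x ∈ A) :
    ∑ A ∈ 𝒜, ‖ttActivity L β t' U μ θ A‖ * Real.exp ((a + δ) * A.card) ≤ a := by
  have hr : siteRatio (β : ℂ) (U : ℂ) (μ : ℂ) ≤ 1 := (siteRatio_ofReal β U μ).le
  have haδ : (0 : ℝ) ≤ a + δ := add_nonneg ha hδ
  have hF : Real.exp (a + δ) + 16 * (|β| * (1 + |t'|)) * Real.exp (1 + 2 * (|β| * (1 + |t'|))) *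
      (Real.exp (a + δ) + a) ^ 2 ≤ Real.exp (a + δ) + a := by linarith
  have key : ∑ A ∈ 𝒜, ‖ttActivity L β t' U μ θ A‖ * Real.exp ((a + δ) * A.card) ≤
      (Real.exp (a + δ) + a) - Real.exp (a + δ) := by
    simp only [ttActivity, siteActivityC_eq_couplingActivity]
    refine sum_norm_couplingActivity_mul_exp_le_catalan (atomicPartitionFn_real_ne_zero β U μ) hr
      (δ := fun b => ‖ttFluxCoupling L β t' θ b‖) (fun _ _ => norm_nonneg _) (fun _ _ => le_rfl) haδ
      (fun v => ?_) hF x 𝒜 h𝒜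
    -- the weighted degree `Σ_{b ∋ v} |c_b| e^{1+|c_b|} ≤ 16 s e^{1+2s}`
    have hexp : ∀ b : Bond (FermionTorus 2 L), Real.exp (1 + ‖ttFluxCoupling L β t' θ b‖) ≤
        Real.exp (1 + 2 * (|β| * (1 + |t'|))) := fun b => by
      rw [Real.exp_le_exp]
      have := norm_ttFluxCoupling_le hL β t' θ b
      linarith
    refine (Finset.sum_le_sum fun b _ => mul_le_mul_of_nonneg_left (hexp b) (norm_nonneg _)).trans ?_
    rw [← Finset.sum_mul]
    exact mul_le_mul_of_nonneg_right (sum_norm_ttFluxCoupling_le β t' θ v _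
      fun b hb => (@mem_verts_iff _ (_) _ _).1 ((@Finset.mem_filter _ _ (_) _ _).1 hb).2) (Real.exp_nonneg _)
  linarith

/-- **Smallness with weight `a`**: under `16 s e^{1+2s} (e^{a+δ}+a)² ≤ a` (`s = |β|(1+|t'|)`, `a, δ > 0`)
the twisted activities satisfy the tree's `IsSmallActivityA · a δ`, for every `θ, U, μ`. [this file] -/
theorem isSmallActivityA_ttActivity (hL : 3 ≤ L) (β t' U μ θ : ℝ) {a δ : ℝ} (ha : 0 < a) (hδ : 0 < δ)
    (hsmall : 16 * (|β| * (1 + |t'|)) * Real.exp (1 + 2 * (|β| * (1 + |t'|))) *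
      (Real.exp (a + δ) + a) ^ 2 ≤ a) :
    IsSmallActivityA (ttActivity L β t' U μ θ) a δ where
  rho_empty := siteActivityC_empty _ _ _ _ _
  a_pos := ha
  delta_pos := hδ
  sum_le x 𝒜 h𝒜 := sum_norm_ttActivity_mul_exp_le_weight hL β t' U μ θ ha.le hδ.le hsmall x 𝒜 h𝒜

/-- **The tail estimate for the Kotecký–Preiss logarithms, weighted form**:
`‖log Ξ(ρ_θ) - log Ξ(ρ_0)‖ ≤ 2a L² e^{-δL}`. [this file] -/
theorem norm_polymerLogZ_ttActivity_sub_le_weight (hL : 3 ≤ L) (β t' U μ θ : ℝ) {a δ : ℝ} (ha : 0 < a)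
    (hδ : 0 < δ)
    (hsmall : 16 * (|β| * (1 + |t'|)) * Real.exp (1 + 2 * (|β| * (1 + |t'|))) *
      (Real.exp (a + δ) + a) ^ 2 ≤ a) :
    ‖polymerLogZ polyInc (ttActivity L β t' U μ θ) (Finset.univ : Finset (FermionTorus 2 L)).powerset -
        polymerLogZ polyInc (ttActivity L β t' U μ 0) (Finset.univ : Finset (FermionTorus 2 L)).powerset‖ ≤
      2 * a * (L : ℝ) ^ 2 * Real.exp (-(δ * L)) := by
  have hL0 : (0 : ℝ) < L := by exact_mod_cast (show 0 < L by omega)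
  have h := (isSmallActivityA_ttActivity hL β t' U μ θ ha hδ hsmall).norm_polymerLogZ_sub_le_of_eq_of_card_lt
    (isSmallActivityA_ttActivity hL β t' U μ 0 ha hδ hsmall) (Finset.univ : Finset (FermionTorus 2 L)).powerset
    hL0 (fun A _ hA => ttActivity_eq_of_card_lt hL β t' U μ θ (by exact_mod_cast hA))
  have hcard : (Fintype.card (FermionTorus 2 L) : ℝ) = (L : ℝ) ^ 2 := by
    simp [FermionTorus, Fintype.card_lex]
  rw [hcard] at h
  exact h

/-- **The Kotecký–Preiss logarithm computes the free energy difference** whenever both activity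
families are `IsSmallActivityA`-small: `Re (log Ξ(ρ_θ) - log Ξ(ρ_0)) = log Z_L(θ) - log Z_L(0)`.
[this file; #181.6 with the weighted smallness as a hypothesis] -/
theorem re_polymerLogZ_sub_eq_log_sub_of_isSmallActivityA (hL : 3 ≤ L) (β t' U μ θ : ℝ)
    {a δ a' δ' : ℝ} (hθ : IsSmallActivityA (ttActivity L β t' U μ θ) a δ)
    (h0 : IsSmallActivityA (ttActivity L β t' U μ 0) a' δ') :
    (polymerLogZ polyInc (ttActivity L β t' U μ θ) (Finset.univ : Finset (FermionTorus 2 L)).powerset -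
        polymerLogZ polyInc (ttActivity L β t' U μ 0) (Finset.univ : Finset (FermionTorus 2 L)).powerset).re =
      Real.log (partitionFn β (hubbardTorusTT'FluxMu L t' U μ θ)).re -
        Real.log (partitionFn β (hubbardTorusTT'FluxMu L t' U μ 0)).re := by
  have hθpos := partitionFn_hubbardTorusTT'FluxMu_re_pos (L := L) β t' U μ θ
  have h0pos := partitionFn_hubbardTorusTT'FluxMu_re_pos (L := L) β t' U μ 0
  have hθre := partitionFn_eq_re (isHermitian_hubbardTorusTT'FluxMu (L := L) t' U μ θ) β
  have h0re := partitionFn_eq_re (isHermitian_hubbardTorusTT'FluxMu (L := L) t' U μ 0) β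
  have hz : atomicPartitionFn (β : ℂ) (U : ℂ) (μ : ℂ) ^ Fintype.card (FermionTorus 2 L) ≠ 0 :=
    pow_ne_zero _ (atomicPartitionFn_real_ne_zero β U μ)
  have hΞ : ∀ θ' : ℝ, polymerPartitionFunction polyInc (ttActivity L β t' U μ θ')
      (Finset.univ : Finset (FermionTorus 2 L)).powerset =
        partitionFn β (hubbardTorusTT'FluxMu L t' U μ θ') /
          atomicPartitionFn (β : ℂ) (U : ℂ) (μ : ℂ) ^ Fintype.card (FermionTorus 2 L) := fun θ' => by
    rw [eq_div_iff hz, partitionFn_hubbardTorusTT'FluxMu_eq_mul hL, mul_comm]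
  have hexp : Complex.exp (polymerLogZ polyInc (ttActivity L β t' U μ θ)
        (Finset.univ : Finset (FermionTorus 2 L)).powerset -
      polymerLogZ polyInc (ttActivity L β t' U μ 0) (Finset.univ : Finset (FermionTorus 2 L)).powerset) =
      (((partitionFn β (hubbardTorusTT'FluxMu L t' U μ θ)).re /
          (partitionFn β (hubbardTorusTT'FluxMu L t' U μ 0)).re : ℝ) : ℂ) := by
    rw [Complex.exp_sub, hθ.exp_polymerLogZ, h0.exp_polymerLogZ, hΞ θ, hΞ 0,
      div_div_div_cancel_right₀ hz, Complex.ofReal_div, ← hθre, ← h0re]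
  rw [re_eq_log_of_exp_eq (div_pos hθpos h0pos) hexp, Real.log_div hθpos.ne' h0pos.ne']

/-- **THEOREM (twist insensitivity at high temperature, weighted Catalan constants).** For `L ≥ 3`,
real `t', U, μ, β, θ`, `a > 0`, `δ > 0` with `16 s e^{1+2s} (e^{a+δ}+a)² ≤ a`, `s = |β|(1+|t'|)`:
`|log Z_L(0) - log Z_L(θ)| ≤ 2a L² e^{-δL}`. [this file] -/
theorem abs_log_partitionFn_twist_sub_le_weight (hL : 3 ≤ L) (t' U μ β θ : ℝ) {a δ : ℝ} (ha : 0 < a)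
    (hδ : 0 < δ)
    (hsmall : 16 * (|β| * (1 + |t'|)) * Real.exp (1 + 2 * (|β| * (1 + |t'|))) *
      (Real.exp (a + δ) + a) ^ 2 ≤ a) :
    |Real.log (partitionFn β (hubbardTorusTT'FluxMu L t' U μ 0)).re -
        Real.log (partitionFn β (hubbardTorusTT'FluxMu L t' U μ θ)).re| ≤
      2 * a * (L : ℝ) ^ 2 * Real.exp (-(δ * L)) := by
  rw [abs_sub_comm, ← re_polymerLogZ_sub_eq_log_sub_of_isSmallActivityA hL β t' U μ θ
    (isSmallActivityA_ttActivity hL β t' U μ θ ha hδ hsmall)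
    (isSmallActivityA_ttActivity hL β t' U μ 0 ha hδ hsmall)]
  exact (Complex.abs_re_le_norm _).trans
    (norm_polymerLogZ_ttActivity_sub_le_weight hL β t' U μ θ ha hδ hsmall)

/-! ### The certified window `T ≥ 400 (|t|+|t'|)` (`a = 3/8`, `δ = 10⁻³`) -/

/-- **Certified instance of (KP-W)**: `16 s e^{1+2s} (e^{3/8+10⁻³} + 3/8)² ≤ 3/8` for `0 ≤ s ≤ 1/400`
(`e ≤ 2.7182818286`, `e^{2s} ≤ 1/(1-2s)`, `e^{0.376} ≤ 1.4566` by Taylor's bound; the left side is then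
`≤ 0.3666`). [this file] -/
theorem kpWeight_of_le_inv_400 {s : ℝ} (hs0 : 0 ≤ s) (hs : s ≤ 1 / 400) :
    16 * s * Real.exp (1 + 2 * s) * (Real.exp (3 / 8 + 1 / 1000) + 3 / 8) ^ 2 ≤ 3 / 8 := by
  have he : Real.exp 1 ≤ 2718281829 / 10 ^ 9 := Real.exp_one_lt_d9.le.trans (by norm_num)
  have h2s : Real.exp (2 * s) ≤ 400 / 398 := by
    refine (Real.exp_bound_div_one_sub_of_interval (by positivity) (by linarith)).trans ?_
    rw [div_le_div_iff₀ (by linarith) (by norm_num)]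
    linarith
  have hB : Real.exp (3 / 8 + 1 / 1000) ≤ 14566 / 10 ^ 4 := by
    refine (Real.exp_bound' (x := 3 / 8 + 1 / 1000) (n := 4) (by norm_num) (by norm_num) (by norm_num)).trans ?_
    norm_num [Finset.sum_range_succ, Nat.factorial]
  have hA : Real.exp (1 + 2 * s) ≤ 2718281829 / 10 ^ 9 * (400 / 398) := by
    rw [Real.exp_add]; exact mul_le_mul he h2s (Real.exp_nonneg _) (by norm_num)
  calc 16 * s * Real.exp (1 + 2 * s) * (Real.exp (3 / 8 + 1 / 1000) + 3 / 8) ^ 2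
      ≤ 16 * (1 / 400) * (2718281829 / 10 ^ 9 * (400 / 398)) * (14566 / 10 ^ 4 + 3 / 8) ^ 2 := by
        gcongr
    _ ≤ 3 / 8 := by norm_num

/-- **THEOREM (twist insensitivity for `T ≥ 400(|t|+|t'|)`).** For `L ≥ 3`, real `t', U, μ, β, θ`
with `|β|(1+|t'|) ≤ 1/400`: `|log Z_L(0) - log Z_L(θ)| ≤ (3/4) L² e^{-L/1000}`. [this file] -/
theorem abs_log_partitionFn_twist_sub_le_of_le_inv_400 (hL : 3 ≤ L) (t' U μ β θ : ℝ)
    (hs : |β| * (1 + |t'|) ≤ 1 / 400) :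
    |Real.log (partitionFn β (hubbardTorusTT'FluxMu L t' U μ 0)).re -
        Real.log (partitionFn β (hubbardTorusTT'FluxMu L t' U μ θ)).re| ≤
      3 / 4 * (L : ℝ) ^ 2 * Real.exp (-((1 / 1000) * L)) := by
  have h := abs_log_partitionFn_twist_sub_le_weight hL t' U μ β θ (a := 3 / 8) (δ := 1 / 1000)
    (by norm_num) (by norm_num) (kpWeight_of_le_inv_400 (by positivity) hs)
  linarith

/-! ### Nodes -/

/-- **Node (bounds.tex Thm 12 (i) with the weighted Catalan constants; PROVED below).** For `L ≥ 3`,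
all real `t', U, μ, β`, every `a > 0` and `δ > 0` with `16 s e^{1+2s} (e^{a+δ}+a)² ≤ a`
(`s = |β|(1+|t'|)`; holds with `a = 3/8`, `δ = 10⁻³` whenever `T ≥ 400(|t|+|t'|)`), and every seam twist `θ`:
`|log Re Z(0) - log Re Z(θ)| ≤ 2a L² e^{-δL}`, `Z(θ) = partitionFn β (hubbardTorusTT'FluxMu L t' U μ θ)` —
uniformly in `U` (both signs) and `μ`. Same shape as #181.1's `HighTemperatureTwistInsensitivityTT'`
(there `2a ↦ a`, `b = δ`, Hölder weights). [programme node: bounds.tex §12 Thm 12 (i); cites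
KoteckyPreiss1986 Thm p. 492, Ueltschi1999 §3] -/
@[conjecture] def HighTemperatureTwistInsensitivityTT'Weighted : Prop :=
  ∀ (L : ℕ) [NeZero L], 3 ≤ L → ∀ (t' U μ β a δ : ℝ), 0 < a → 0 < δ →
    16 * (|β| * (1 + |t'|)) * Real.exp (1 + 2 * (|β| * (1 + |t'|))) * (Real.exp (a + δ) + a) ^ 2 ≤ a →
    ∀ θ : ℝ,
      |Real.log (partitionFn β (hubbardTorusTT'FluxMu L t' U μ 0)).re -
          Real.log (partitionFn β (hubbardTorusTT'FluxMu L t' U μ θ)).re| ≤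
        2 * a * (L : ℝ) ^ 2 * Real.exp (-(δ * L))

/-- PROOF of the node `HighTemperatureTwistInsensitivityTT'Weighted`. [this file] -/
theorem highTemperatureTwistInsensitivityTT'Weighted_holds : HighTemperatureTwistInsensitivityTT'Weighted :=
  fun _L _ hL t' U μ β _a _δ ha hδ hsmall θ =>
    abs_log_partitionFn_twist_sub_le_weight hL t' U μ β θ ha hδ hsmall

/-- **Node (bounds.tex Thm 12 (ii), weighted Catalan constants; PROVED below): no thermal phase
stiffness.** Under the hypotheses of `HighTemperatureTwistInsensitivityTT'Weighted` with `β > 0`, every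
flux stiffness `ρ_s` of the grand-canonical free energy — `β ρ_s θ² ≤ log Re Z(0) - log Re Z(θ)` for
`|θ| ≤ θ₀`, `θ₀ > 0` — satisfies `ρ_s ≤ 2a L² e^{-δL} / (β θ₀²)`, uniformly in `U, μ`; in particular
`ρ_s → 0` as `L → ∞` for every `T ≥ 400(|t|+|t'|)`. [programme node: bounds.tex §12 Thm 12 (ii); cites
ScalapinoWhiteZhang1993] -/
@[conjecture] def HighTemperatureNoThermalStiffnessTT'Weighted : Prop :=
  ∀ (L : ℕ) [NeZero L], 3 ≤ L → ∀ (t' U μ β a δ ρs θ₀ : ℝ), 0 < β → 0 < θ₀ → 0 < a → 0 < δ →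
    16 * (|β| * (1 + |t'|)) * Real.exp (1 + 2 * (|β| * (1 + |t'|))) * (Real.exp (a + δ) + a) ^ 2 ≤ a →
    (∀ θ : ℝ, |θ| ≤ θ₀ → β * ρs * θ ^ 2 ≤
        Real.log (partitionFn β (hubbardTorusTT'FluxMu L t' U μ 0)).re -
          Real.log (partitionFn β (hubbardTorusTT'FluxMu L t' U μ θ)).re) →
    ρs ≤ 2 * a * (L : ℝ) ^ 2 * Real.exp (-(δ * L)) / (β * θ₀ ^ 2)

/-- PROOF of the node `HighTemperatureNoThermalStiffnessTT'Weighted`: evaluate the stiffness hypothesis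
at `θ = θ₀` and divide by `β θ₀² > 0`. [this file] -/
theorem highTemperatureNoThermalStiffnessTT'Weighted_holds : HighTemperatureNoThermalStiffnessTT'Weighted := by
  intro L _ hL t' U μ β a δ ρs θ₀ hβ hθ₀ ha hδ hsmall hstiff
  have hins := abs_log_partitionFn_twist_sub_le_weight hL t' U μ β θ₀ ha hδ hsmall
  have hE := hstiff θ₀ (by rw [abs_of_pos hθ₀])
  have hpos : 0 < β * θ₀ ^ 2 := mul_pos hβ (pow_pos hθ₀ 2)
  rw [le_div_iff₀ hpos]
  calc ρs * (β * θ₀ ^ 2) = β * ρs * θ₀ ^ 2 := by ring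
    _ ≤ _ := hE
    _ ≤ _ := le_abs_self _
    _ ≤ _ := hins

/-- **Node (certified reading `T ≥ 400(|t|+|t'|)` of Thm 12 (i); PROVED below).** For `L ≥ 3`, real
`t', U, μ`, `β > 0` with `β(1+|t'|) ≤ 1/400`, and every seam twist `θ`:
`|log Re Z(0) - log Re Z(θ)| ≤ (3/4) L² e^{-L/1000}`. Sharpens #195.5's `…At610` (window `610`, bound
`2 L² e^{-L/1000}`) by the optimal anchored weight `a = 3/8` (`kpWeight_of_le_inv_400`).
[programme node: bounds.tex §12 Thm 12 (i), Remark 12(d)] -/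
@[conjecture] def HighTemperatureTwistInsensitivityTT'At400 : Prop :=
  ∀ (L : ℕ) [NeZero L], 3 ≤ L → ∀ (t' U μ β : ℝ), 0 < β → β * (1 + |t'|) ≤ 1 / 400 →
    ∀ θ : ℝ,
      |Real.log (partitionFn β (hubbardTorusTT'FluxMu L t' U μ 0)).re -
          Real.log (partitionFn β (hubbardTorusTT'FluxMu L t' U μ θ)).re| ≤
        3 / 4 * (L : ℝ) ^ 2 * Real.exp (-((1 / 1000) * L))

/-- PROOF of the node `HighTemperatureTwistInsensitivityTT'At400`. [this file] -/
theorem highTemperatureTwistInsensitivityTT'At400_holds : HighTemperatureTwistInsensitivityTT'At400 := by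
  intro L _ hL t' U μ β hβ hT θ
  exact abs_log_partitionFn_twist_sub_le_of_le_inv_400 hL t' U μ β θ (by rwa [abs_of_pos hβ])

/-- **Node (certified reading `T ≥ 400(|t|+|t'|)` of Thm 12 (ii); PROVED below): no thermal phase
stiffness.** For `L ≥ 3`, real `t', U, μ`, `β > 0` with `β(1+|t'|) ≤ 1/400`: every flux stiffness
`ρ_s` (`β ρ_s θ² ≤ log Re Z(0) - log Re Z(θ)` for `|θ| ≤ θ₀`, `θ₀ > 0`) satisfies
`ρ_s ≤ (3/4) L² e^{-L/1000} / (β θ₀²)`, uniformly in `U`, `μ`. Unconditional sibling of #191's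
`HighTemperatureNoThermalStiffnessTT'At160` (window 160, proved there only from the open node (i)).
[programme node: bounds.tex §12 Thm 12 (ii), Remark 12(d)] -/
@[conjecture] def HighTemperatureNoThermalStiffnessTT'At400 : Prop :=
  ∀ (L : ℕ) [NeZero L], 3 ≤ L → ∀ (t' U μ β ρs θ₀ : ℝ), 0 < β → 0 < θ₀ →
    β * (1 + |t'|) ≤ 1 / 400 →
    (∀ θ : ℝ, |θ| ≤ θ₀ → β * ρs * θ ^ 2 ≤
        Real.log (partitionFn β (hubbardTorusTT'FluxMu L t' U μ 0)).re -
          Real.log (partitionFn β (hubbardTorusTT'FluxMu L t' U μ θ)).re) →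
    ρs ≤ 3 / 4 * (L : ℝ) ^ 2 * Real.exp (-((1 / 1000) * L)) / (β * θ₀ ^ 2)

/-- PROOF of the node `HighTemperatureNoThermalStiffnessTT'At400` (the weighted node at `a = 3/8`,
`δ = 10⁻³` and the certified numerical instance). [this file] -/
theorem highTemperatureNoThermalStiffnessTT'At400_holds : HighTemperatureNoThermalStiffnessTT'At400 := by
  intro L _ hL t' U μ β ρs θ₀ hβ hθ₀ hT hstiff
  have hT' : |β| * (1 + |t'|) ≤ 1 / 400 := by rwa [abs_of_pos hβ]
  have h := highTemperatureNoThermalStiffnessTT'Weighted_holds L hL t' U μ β (3 / 8) (1 / 1000) ρs θ₀ hβ hθ₀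
    (by norm_num) (by norm_num) (kpWeight_of_le_inv_400 (by positivity) hT') hstiff
  have hpos : 0 < β * θ₀ ^ 2 := mul_pos hβ (pow_pos hθ₀ 2)
  rw [le_div_iff₀ hpos] at h ⊢
  linarith

end Torus

end Summit.HubbardSuperconductivity.HubbardLadder.Bounds
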